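import Mathlib
import Summits.RiemannHypothesis.RiemannHypothesis.Theorems.WeilGroundStateArchimedeanWindowSimpleEvenTrial3
import HarnessLib

/-!
# `EvenWinsArch` — data of the rescaled bump `trialFun (x/(3r))`

For `0 < r ≤ 1/3` the rescaled parabolic bump `f_r(x) = trialFun (x/(3r)) = (1 − x²/r²)⁺` is in `L²`,
vanishes off `[-r, r]`, has `‖f_r‖₂² = (16/15) r`, and its pole form satisfies
`P(f_r) ≤ 2 (∫ f_r cosh(x/2))² ≤ (32/9) r² (1 + r²/36)²`
(`cosh(x/2) ≤ 1 + (9/71) x²` on `|x| ≤ 1/3`, then a quartic polynomial integral: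
`∫ f_r cosh(x/2) ≤ (4/3) r + (12/355) r³ ≤ (4/3) r (1 + r²/36)`).

Route `RiemannHypothesis/WeilParity`, crux `EvenWinsArch` (stmt-RiemannHypothesis-15433), stub `stub_bumpData`
of the line `birth` (the data fed to the form-domain Rayleigh principle for the even-sector ceilings).
-/

namespace Summit.RiemannHypothesis.RiemannHypothesis.Theorems.WeilParity.EvenWinsArch

-- `Summit.RiemannHypothesis.RiemannHypothesis.…` repeats a namespace component by design (D-0017 layout).
set_option linter.dupNamespace false

open Literature.NumberTheory.LFunctions
open Summit.RiemannHypothesis.RiemannHypothesis.Theorems.WeilGroundState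
open MeasureTheory Set Filter

/-- For `r > 0`: `9 (x/(3r))² < 1 ↔ -r < x < r`. [folklore] -/
theorem bumpData_sq_lt_one_iff {r : ℝ} (hr : 0 < r) (x : ℝ) :
    9 * (x / (3 * r)) ^ 2 < 1 ↔ -r < x ∧ x < r := by
  rw [sq_lt_one_iff]
  have h3 : (0 : ℝ) < 3 * r := by positivity
  rw [lt_div_iff₀ h3, div_lt_iff₀ h3]
  constructor <;> rintro ⟨h1, h2⟩ <;> constructor <;> linarith

/-- For `r > 0` and `-r ≤ x ≤ r`: `9 (x/(3r))² ≤ 1`. [folklore] -/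
theorem bumpData_sq_le_one {r x : ℝ} (hr : 0 < r) (h1 : -r ≤ x) (h2 : x ≤ r) :
    9 * (x / (3 * r)) ^ 2 ≤ 1 := by
  have hr0 : r ≠ 0 := hr.ne'
  have e : 9 * (x / (3 * r)) ^ 2 = (x / r) ^ 2 := by
    field_simp
    ring
  rw [e, sq_le_one_iff_abs_le_one, abs_le, le_div_iff₀ hr, div_le_iff₀ hr]
  exact ⟨by linarith, by linarith⟩

/-- The rescaled bump vanishes off `[-r, r]`. [folklore] -/
theorem bumpData_eq_zero {r : ℝ} (hr : 0 < r) {x : ℝ} (hx : x ∉ Icc (-r) r) :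
    trialFun (x / (3 * r)) = 0 := by
  refine trialFun_eq_zero_of_not_mem fun h ↦ hx ?_
  have h3 : (0 : ℝ) < 3 * r := by positivity
  rw [mem_Icc, le_div_iff₀ h3, div_le_iff₀ h3] at h
  exact ⟨by linarith [h.1], by linarith [h.2]⟩

/-- The rescaled bump is continuous. [folklore] -/
theorem continuous_bumpData (r : ℝ) : Continuous fun x : ℝ ↦ trialFun (x / (3 * r)) :=
  continuous_trialFun.comp' (continuous_id.div_const _)

/-- The rescaled bump is in `L²`. [folklore] -/
theorem memLp_bumpData {r : ℝ} (hr : 0 < r) : MemLp (fun x : ℝ ↦ trialFun (x / (3 * r))) 2 volume :=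
  (continuous_bumpData r).memLp_of_hasCompactSupport
    (HasCompactSupport.intro isCompact_Icc fun _ hx ↦ bumpData_eq_zero hr hx)

/-- `‖f_r‖₂² = 3r · (16/45) = (16/15) r`. [folklore] -/
theorem integral_norm_sq_bumpData {r : ℝ} (hr : 0 < r) :
    ∫ x : ℝ, ‖trialFun (x / (3 * r))‖ ^ 2 = 16 / 15 * r := by
  have h : ∫ x : ℝ, ‖trialFun (x / (3 * r))‖ ^ 2 = |3 * r| • ∫ y : ℝ, ‖trialFun y‖ ^ 2 :=
    Measure.integral_comp_div (fun y : ℝ ↦ ‖trialFun y‖ ^ 2) (3 * r)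
  rw [h, integral_norm_sq_trialFun, smul_eq_mul, abs_of_pos (by positivity : (0 : ℝ) < 3 * r)]
  ring

/-- The real integral `∫ (1 − x²/r²)⁺ cosh(x/2) dx` is non-negative and at most `(4/3) r (1 + r²/36)`
for `0 < r ≤ 1/3`. [folklore] -/
theorem integral_bumpData_mul_cosh_le {r : ℝ} (hr : 0 < r) (hr3 : r ≤ 1 / 3) :
    0 ≤ ∫ x, max (1 - 9 * (x / (3 * r)) ^ 2) 0 * Real.cosh (x / 2) ∧
      ∫ x, max (1 - 9 * (x / (3 * r)) ^ 2) 0 * Real.cosh (x / 2) ≤ 4 / 3 * r * (1 + r ^ 2 / 36) := by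
  refine ⟨integral_nonneg fun x ↦ mul_nonneg (le_max_right _ _) (Real.cosh_pos _).le, ?_⟩
  have hr0 : r ≠ 0 := hr.ne'
  have h1 : ∫ x, max (1 - 9 * (x / (3 * r)) ^ 2) 0 * Real.cosh (x / 2) =
      ∫ x in (-r)..r, max (1 - 9 * (x / (3 * r)) ^ 2) 0 * Real.cosh (x / 2) := by
    symm
    apply intervalIntegral.integral_eq_integral_of_support_subset
    intro x hx
    rw [Function.mem_support] at hx
    have h9 : 9 * (x / (3 * r)) ^ 2 < 1 := by
      by_contra h
      exact hx (by rw [max_eq_right (by linarith), zero_mul])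
    have := (bumpData_sq_lt_one_iff hr x).1 h9
    exact ⟨this.1, this.2.le⟩
  have h2 : ∫ x in (-r)..r, ((1 : ℝ) + 0 * x + (9 / 71 - 1 / r ^ 2) * x ^ 2 + 0 * x ^ 3 +
      (-(9 / (71 * r ^ 2))) * x ^ 4) = 4 / 3 * r + 12 / 355 * r ^ 3 := by
    rw [integral_poly4]
    field_simp
    ring
  rw [h1]
  calc ∫ x in (-r)..r, max (1 - 9 * (x / (3 * r)) ^ 2) 0 * Real.cosh (x / 2)
      ≤ ∫ x in (-r)..r, ((1 : ℝ) + 0 * x + (9 / 71 - 1 / r ^ 2) * x ^ 2 + 0 * x ^ 3 +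
          (-(9 / (71 * r ^ 2))) * x ^ 4) := by
        refine intervalIntegral.integral_mono_on (by linarith)
          ((Continuous.intervalIntegrable (by fun_prop) _ _))
          ((Continuous.intervalIntegrable (by fun_prop) _ _)) fun x hx ↦ ?_
        have hx' : 9 * (x / (3 * r)) ^ 2 ≤ 1 := bumpData_sq_le_one hr hx.1 hx.2
        have hx9 : 9 * x ^ 2 ≤ 1 := by nlinarith [hx.1, hx.2]
        rw [max_eq_left (by linarith)]
        have hc := cosh_half_le hx9
        have h0 : 0 ≤ 1 - 9 * (x / (3 * r)) ^ 2 := by linarith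
        calc (1 - 9 * (x / (3 * r)) ^ 2) * Real.cosh (x / 2)
            ≤ (1 - 9 * (x / (3 * r)) ^ 2) * (1 + 9 / 71 * x ^ 2) := mul_le_mul_of_nonneg_left hc h0
          _ = _ := by
              field_simp
              ring
    _ = 4 / 3 * r + 12 / 355 * r ^ 3 := h2
    _ ≤ 4 / 3 * r * (1 + r ^ 2 / 36) := by nlinarith [pow_pos hr 3]

/-- **The pole form of the rescaled bump**: `P(f_r) ≤ 2 (∫ f_r cosh(x/2))² ≤ (32/9) r² (1 + r²/36)²`
(the `sinh` part enters with a minus sign and is dropped). [folklore] -/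
theorem weilPoleForm_bumpData_le {r : ℝ} (hr : 0 < r) (hr3 : r ≤ 1 / 3) :
    weilPoleForm (fun x : ℝ ↦ trialFun (x / (3 * r))) ≤ 32 / 9 * r ^ 2 * (1 + r ^ 2 / 36) ^ 2 := by
  obtain ⟨h0, h1⟩ := integral_bumpData_mul_cosh_le hr hr3
  show 2 * ‖∫ t : ℝ, trialFun (t / (3 * r)) * (Real.cosh (t / 2) : ℂ)‖ ^ 2 -
      2 * ‖∫ t : ℝ, trialFun (t / (3 * r)) * (Real.sinh (t / 2) : ℂ)‖ ^ 2 ≤ _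
  have hc : ∫ t, trialFun (t / (3 * r)) * (Real.cosh (t / 2) : ℂ) =
      ((∫ x, max (1 - 9 * (x / (3 * r)) ^ 2) 0 * Real.cosh (x / 2) : ℝ) : ℂ) := by
    rw [← integral_complex_ofReal]
    congr 1 with t
    rw [trialFun_apply]
    push_cast
    ring
  rw [hc, Complex.norm_real, Real.norm_of_nonneg h0]
  have h2 : 0 ≤ ‖∫ t, trialFun (t / (3 * r)) * (Real.sinh (t / 2) : ℂ)‖ ^ 2 := sq_nonneg _
  have h3 : (∫ x, max (1 - 9 * (x / (3 * r)) ^ 2) 0 * Real.cosh (x / 2)) ^ 2 ≤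
      (4 / 3 * r * (1 + r ^ 2 / 36)) ^ 2 := pow_le_pow_left₀ h0 h1 2
  nlinarith [h2, h3]

/-- **Stub T5 — data of the rescaled bump.** For `0 < r ≤ 1/3`, `f(x) = trialFun (x/(3r))` is in `L²`,
vanishes off `[-r, r]`, has `‖f‖₂² = (16/15) r`, and pole form
`P(f) ≤ 2 |∫ f cosh(x/2)|² ≤ (32/9) r² (1 + r²/36)²`. [folklore] -/
theorem stub_bumpData :
    ∀ r : ℝ, 0 < r → r ≤ 1 / 3 →
      MeasureTheory.MemLp
          (fun x : ℝ ↦ Summit.RiemannHypothesis.RiemannHypothesis.Theorems.WeilGroundState.trialFun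
            (x / (3 * r))) 2 MeasureTheory.volume ∧
        (∀ x : ℝ, x ∉ Set.Icc (-r) r →
          Summit.RiemannHypothesis.RiemannHypothesis.Theorems.WeilGroundState.trialFun (x / (3 * r)) = 0) ∧
        ∫ x : ℝ, ‖Summit.RiemannHypothesis.RiemannHypothesis.Theorems.WeilGroundState.trialFun
            (x / (3 * r))‖ ^ 2 = 16 / 15 * r ∧
        Literature.NumberTheory.LFunctions.weilPoleForm
            (fun x : ℝ ↦ Summit.RiemannHypothesis.RiemannHypothesis.Theorems.WeilGroundState.trialFun
              (x / (3 * r))) ≤ 32 / 9 * r ^ 2 * (1 + r ^ 2 / 36) ^ 2 :=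
  fun _ hr hr3 ↦ ⟨memLp_bumpData hr, fun _ hx ↦ bumpData_eq_zero hr hx, integral_norm_sq_bumpData hr,
    weilPoleForm_bumpData_le hr hr3⟩

end Summit.RiemannHypothesis.RiemannHypothesis.Theorems.WeilParity.EvenWinsArch
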